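import Summits.HubbardSuperconductivity.HubbardLadder.Bounds.SpinCorrelationEtaLineEuclid
import Literature.MathematicalPhysics.QuantumLattice.HubbardBondPairDecaySharp
import Mathlib.Order.LiminfLimsup
import HarnessLib
import HarnessLib.Audit

/-!
# Hubbard ladder — Bounds: the sharp Koma–Tasaki `η`-line for the PAIR FIELD of the summit
# (`localPair g`, every form factor `g`, in particular `d_{x²-y²}`), machine-checked
# (bounds.tex Thm 10⁗; pair-field twin of `PairCorrelationEtaLineEuclid.lean`)

HONEST FRAMING (cell pub-hubbard): ladder R1–R4 with certified numbers; no claim on H/H₀. These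
are bounds for a MODEL CLASS — the grand-canonical Hubbard model `hubbardTorusWith 2 L t U μ` on
the square torus `(ℤ/Lℤ)²` (every `L ≥ 1`, all real `t, U, μ`, every `β > 0`); no materials
claim. Companion text: `pub-hubbard/paper/bounds.tex` §Theorem 10 (Thm 10⁗); tables
`pub-hubbard/pub-hubbard-bounds/BOUNDS.md` (row T8⁸) and `EXTREMISERS.md` §5i.

## Content

The summit's order parameter is the `d_{x²-y²}` pair field `Δ_d = Σ_x P_x`,
`P_x = localPair dWaveFormFactor L x = Σ_{e∈{0,±e₁,±e₂}} (g e/√2) b_{x,x+e}` with the singlet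
bond pairs `b_{uv} = c_{u↑}c_{v↓} - c_{u↓}c_{v↑}`. The barrier entry
`Literature/Barriers/HubbardSuperconductivity/HohenbergMerminWagnerPairing.lean` proves
Koma–Tasaki's footnote-[10] power law `|⟨(P_x)† P_y⟩_{β,L}| ≤ C_g (dist+1)^{-f}` with the weak
explicit exponent `f = pairDecayExponent(β|t|) ≤ 1/(64β|t|)` (hopping norm counted twice,
radial `ℓ^∞` monopole of Dirichlet energy `128q²H(R)`). The new Literature file
`HubbardBondPairDecaySharp` (this seat) supplies the SHARP ingredients for bond pairs — the
printed hopping norm (`norm_thermalCorr_bondPair_le_exp_sharp`), the FLAT Euclidean truncated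
logarithmic dipole (`exists_euclidLogDipole_flat`: the dipole of `exists_euclidLogDipole` is
constant on the unit neighbourhoods of its centres, so a bond pair carries gauge charge exactly
`2`), and `norm_thermalCorr_localPair_le_sharp`: for every `q ≥ 0` with
`f := 4q - 4πβ|t|q² ≥ 0`, uniformly in `L`,
`|⟨(P_x)† P_y⟩_{β,L}| ≤ 4(Σ_e |g e/√2|)² K(q) 5^f (dist(x,y)+1)^{-f}`,
`K(q) = exp[2β|t|(2πq² + 76q² + 544q⁴e^{2q²})]` — the SAME exponent as for the on-site pair
(`norm_pairCorr_le_rpow_euclid`) and the transverse spin (`norm_spinCorr_le_rpow_euclid`),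
optimum `q* = 1/(2πβ|t|)`, `f* = 1/(πβ|t|) = T/(π|t|)`. Proved here (ladder nodes):

* `PairFieldEtaLineEuclid` / `pairFieldEtaLineEuclid_holds` — torus-uniform form, EVERY form
  factor `g`: `β|t| < 4/π` (`T > (π/4)|t|`) ⟹ `∃ f > 1/4, C`:
  `|⟨(P_x)† P_y⟩_{β,L}| ≤ C (dist+1)^{-f}` for all `L, x, y`;
* `PairFieldEtaLineSharp` / `pairFieldEtaLineSharp_holds` — thermodynamic-limit form, every
  `g`, `t ≠ 0`: for every `ε > 0` and `|z| ≥ R(ε)`,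
  `limsup_{L→∞} |⟨(P_0)† P_z⟩_{β,L+1}| ≤ |z|^{-(1-ε)/(πβ|t|)}`; i.e. the McBryan–Spencer exponent
  `η_pair(T) ≥ T/(π|t|)` for every finite-range singlet pair field of the Hubbard model at every
  `U`, `μ` — improving the barrier's `pairDecayExponent` by the factor `≥ 64/π ≈ 20`
  (`128/π ≈ 41` asymptotically);
* `dWavePairField_decay_torus`, `dWavePairField_limsup_le_rpow` — the two statements for the
  summit's `localPair dWaveFormFactor` verbatim.

Reading (bounds.tex Cor 10.3): for `T > (π/4)|t| ≈ 0.785|t|` the `d_{x²-y²}` (and every other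
finite-range singlet) pair-field correlation of the 2D Hubbard model decays faster than the
Nelson–Kosterlitz/BKT borderline `r^{-1/4}`, whatever `U` and the filling — a superconducting
quasi-long-range order with `η ≤ 1/4` (the universal-jump value at a BKT transition) can only
occur at `T ≤ (π/4)|t|`; unconditional, machine-checked. NOT claimed: optimality of `1/(πβ|t|)`
within the method, anything at `T < (π/4)|t|`, any LOWER bound on correlations, the `t`–`t'`
class (routine successor: the two-graph dipole of `TorusEuclidLogDipoleDiag` made flat).

References (keys of `lean/references.bib`): KomaTasakiPRL1992 (Theorem, eqs. (5)–(13),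
footnote [10]); SuSuzuki1998; McBryanSpencer1977; NelsonKosterlitz1977; Scalapino1995 §2;
FriedliVelenikSMLS2017 Thm 9.12.
-/

noncomputable section

namespace Summit.HubbardSuperconductivity.HubbardLadder.Bounds

open Matrix Finset NormedSpace
open Literature.MathematicalPhysics.QuantumLattice Literature.Probability.LatticeModels
  Literature.Barriers.HubbardSuperconductivity
open scoped Matrix.Norms.L2Operator ComplexOrder

/-! ### The pair-field weight -/

/-- The weight `A_g = 4 (Σ_{e∈{0,±e₁,±e₂}} |g e/√2|)²` of the form factor `g` (the a priori bound
of the pair-field two-point function; `32` for `dWaveFormFactor`). -/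
def pairFieldWeight (g : Site 2 → ℝ) : ℝ :=
  4 * (∑ e ∈ insert (0 : Site 2) unitSteps, |g e / Real.sqrt 2|) ^ 2

/-- `A_g ≥ 0`. -/
theorem pairFieldWeight_nonneg (g : Site 2 → ℝ) : 0 ≤ pairFieldWeight g := by
  unfold pairFieldWeight
  positivity

/-- **The sharp explicit pair-field bound (machine-checked in Literature
`HubbardBondPairDecaySharp`), restated with `pairFieldWeight`.** For every form factor `g`, all
real `t, U, μ`, `β ≥ 0`, every `q ≥ 0` with `f := 4q - 4πβ|t|q² ≥ 0` and all sites `x, y` of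
`(ℤ/Lℤ)²`: `|⟨(P_x)† P_y⟩_{β,L}| ≤ A_g K(q) 5^f (dist(x,y)+1)^{-f}`, uniformly in `L`. -/
theorem norm_pairFieldCorr_le_rpow_euclid (L : ℕ) [NeZero L] (g : Site 2 → ℝ)
    (t U μ β q : ℝ) (hβ : 0 ≤ β) (hq : 0 ≤ q)
    (hf : 0 ≤ 4 * q - 4 * Real.pi * (β * |t|) * q ^ 2) (x y : TorusSite 2 L) :
    ‖(hubbardTorusWith 2 L t U μ).thermalCorr β (localPair g L x)ᴴ (localPair g L y)‖ ≤
      pairFieldWeight g * (Real.exp (2 * (β * |t|) *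
          (2 * Real.pi * q ^ 2 + 76 * q ^ 2 + 544 * q ^ 4 * Real.exp (2 * q ^ 2))) *
        ((5 : ℝ) ^ (4 * q - 4 * Real.pi * (β * |t|) * q ^ 2) *
          ((torusDist x y : ℝ) + 1) ^ (-(4 * q - 4 * Real.pi * (β * |t|) * q ^ 2)))) :=
  norm_thermalCorr_localPair_le_sharp L g t U μ β q hβ hq hf x y

/-- The a priori bound: `|⟨(P_x)† P_y⟩_{β,L}| ≤ A_g` (`φ = 0`). -/
theorem norm_pairFieldCorr_le_weight (L : ℕ) [NeZero L] (g : Site 2 → ℝ) (t U μ β : ℝ)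
    (hβ : 0 ≤ β) (x y : TorusSite 2 L) :
    ‖(hubbardTorusWith 2 L t U μ).thermalCorr β (localPair g L x)ᴴ (localPair g L y)‖ ≤
      pairFieldWeight g :=
  norm_thermalCorr_localPair_le_apriori L g t U μ β hβ x y

/-! ### The sharp pair-field `η`-line, torus-uniform form -/

/-- **Cor 10.3 (torus form, sharp constant, every form factor; PROVED below).** Nearest-neighbour
Hubbard model on `(ℤ/Lℤ)²`, any form factor `g : ℤ² → ℝ` (pair field
`P_x = Σ_{e∈{0,±e₁,±e₂}} (g e/√2) b_{x,x+e}`; `g = dWaveFormFactor` is the summit's), any real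
`t, U, μ`, `β > 0` with `β|t| < 4/π` (temperature `T > (π/4)|t| ≈ 0.785|t|`, the
McBryan–Spencer/Koma–Tasaki `η = 1/4` line with the printed hopping norm): there are `f > 1/4`
and `C` with `|⟨(P_x)† P_y⟩_{β,L}| ≤ C (dist(x,y)+1)^{-f}` for all `L, x, y` — no pair-field
quasi-long-range order with `η ≤ 1/4` there, whatever `U`, `μ`. kind: support (PROVED).
Why it might fail: it cannot (proved); NOT claimed: optimality of the exponent within the
method, any lower bound. Sources: KomaTasakiPRL1992 Theorem, eqs. (5)–(13), footnote [10];
SuSuzuki1998; McBryanSpencer1977; NelsonKosterlitz1977; this cell bounds.tex Thm 10⁗. -/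
@[conjecture] def PairFieldEtaLineEuclid : Prop :=
  ∀ (g : Site 2 → ℝ) (t U μ β : ℝ), 0 < β → β * |t| < 4 / Real.pi →
    ∃ f C : ℝ, 1 / 4 < f ∧ ∀ (L : ℕ) [NeZero L] (x y : TorusSite 2 L),
      ‖(hubbardTorusWith 2 L t U μ).thermalCorr β (localPair g L x)ᴴ (localPair g L y)‖ ≤
        C * ((torusDist x y : ℝ) + 1) ^ (-f)

/-- **`PairFieldEtaLineEuclid` holds** (witness `q = 1/4` when `πβ|t| ≤ 2`, `f = 1 - πβ|t|/4 ≥ 1/2`;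
else `q = 1/(2πβ|t|)`, `f = 1/(πβ|t|) > 1/4`; `C = A_g K(q) 5^f`). -/
theorem pairFieldEtaLineEuclid_holds : PairFieldEtaLineEuclid := by
  intro g t U μ β hβ hb
  have hβt : 0 ≤ β * |t| := mul_nonneg hβ.le (abs_nonneg t)
  have hπ := Real.pi_pos
  have hb4 : Real.pi * (β * |t|) < 4 := by
    have := (lt_div_iff₀ hπ).1 hb
    linarith
  by_cases hc : Real.pi * (β * |t|) ≤ 2
  · -- `q = 1/4`
    have hf0 : 0 ≤ 4 * (1 / 4 : ℝ) - 4 * Real.pi * (β * |t|) * (1 / 4 : ℝ) ^ 2 := by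
      nlinarith
    refine ⟨4 * (1 / 4 : ℝ) - 4 * Real.pi * (β * |t|) * (1 / 4 : ℝ) ^ 2,
      pairFieldWeight g * (Real.exp (2 * (β * |t|) * (2 * Real.pi * (1 / 4 : ℝ) ^ 2 +
        76 * (1 / 4 : ℝ) ^ 2 + 544 * (1 / 4 : ℝ) ^ 4 * Real.exp (2 * (1 / 4 : ℝ) ^ 2))) *
        (5 : ℝ) ^ (4 * (1 / 4 : ℝ) - 4 * Real.pi * (β * |t|) * (1 / 4 : ℝ) ^ 2)),
      by nlinarith, fun L _ x y => ?_⟩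
    rw [mul_assoc, mul_assoc]
    exact norm_pairFieldCorr_le_rpow_euclid L g t U μ β (1 / 4) hβ.le (by norm_num) hf0 x y
  · -- `q = q* = 1/(2πβ|t|)`
    have hc' : 2 < Real.pi * (β * |t|) := not_le.1 hc
    have hb0 : 0 < β * |t| := by
      rcases hβt.eq_or_lt with h | h
      · rw [← h, mul_zero] at hc'; linarith
      · exact h
    set q : ℝ := 1 / (2 * Real.pi * (β * |t|)) with hq
    have hq0 : 0 ≤ q := by positivity
    have hfval : 4 * q - 4 * Real.pi * (β * |t|) * q ^ 2 = 1 / (Real.pi * (β * |t|)) := by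
      rw [hq]
      field_simp
      ring
    have hf4 : 1 / 4 < 4 * q - 4 * Real.pi * (β * |t|) * q ^ 2 := by
      rw [hfval, div_lt_div_iff₀ (by norm_num) (by positivity)]
      linarith
    refine ⟨4 * q - 4 * Real.pi * (β * |t|) * q ^ 2,
      pairFieldWeight g * (Real.exp (2 * (β * |t|) * (2 * Real.pi * q ^ 2 + 76 * q ^ 2 +
        544 * q ^ 4 * Real.exp (2 * q ^ 2))) *
        (5 : ℝ) ^ (4 * q - 4 * Real.pi * (β * |t|) * q ^ 2)), hf4, fun L _ x y => ?_⟩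
    rw [mul_assoc, mul_assoc]
    exact norm_pairFieldCorr_le_rpow_euclid L g t U μ β q hβ.le hq0 (by linarith) x y

/-! ### The sharp pair-field exponent `η_pair(T) ≥ T/(π|t|)`, thermodynamic-limit form -/

/-- **Thm 10⁗ (the sharp Koma–Tasaki pair-field decay exponent, every form factor; PROVED
below).** For every form factor `g`, all real `U, μ`, every `t ≠ 0`, `β > 0` and `ε > 0` there
is `R` such that for every `z ∈ ℤ²` with `|z| ≥ R`,
`limsup_{L→∞} |⟨(P_0)† P_z⟩_{β,L+1}| ≤ |z|^{-(1-ε)/(πβ|t|)}` — the pair-field correlations of the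
2D Hubbard model decay at least as fast as `|z|^{-η}` with `η = T/(π|t|)` (McBryan–Spencer's
exponent for the plane rotator, with Koma–Tasaki's printed hopping norm; the barrier file's
`pairDecayExponent` is `≤ 1/(64β|t|)`). The hypothesis `t ≠ 0` only excludes the atomic limit,
where the exponent would be the junk value `0` while the weight `A_g` may exceed `1`.
kind: support (PROVED). Why it might fail: it cannot (proved); the `limsup` form sidesteps the
(unformalised) infinite-volume Gibbs state exactly as `PairEtaLineSharp` does. Sources:
KomaTasakiPRL1992 Theorem and footnote [10]; SuSuzuki1998; McBryanSpencer1977; this cell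
bounds.tex Thm 10⁗. -/
@[conjecture] def PairFieldEtaLineSharp : Prop :=
  ∀ (g : Site 2 → ℝ) (t U μ β : ℝ), t ≠ 0 → 0 < β → ∀ ε : ℝ, 0 < ε →
    ∃ R : ℝ, ∀ z : Fin 2 → ℤ, R ≤ intNorm z →
      Filter.limsup (fun L : ℕ => ‖(hubbardTorusWith 2 (L + 1) t U μ).thermalCorr β
          (localPair g (L + 1) (torusSiteOfInt (L + 1) 0))ᴴ
          (localPair g (L + 1) (torusSiteOfInt (L + 1) z))‖)
        Filter.atTop ≤ intNorm z ^ (-((1 - ε) / (Real.pi * β * |t|)))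

/-- **`PairFieldEtaLineSharp` holds**: `norm_pairFieldCorr_le_rpow_euclid` at `q* = 1/(2πβ|t|)`
(`f* = 1/(πβ|t|)`) fed into `exists_limsup_le_rpow` with constant `(A_g + 1) K(q*)` and slack
`e = ε f*`. -/
theorem pairFieldEtaLineSharp_holds : PairFieldEtaLineSharp := by
  intro g t U μ β ht hβ ε hε
  have hβt : 0 ≤ β * |t| := mul_nonneg hβ.le (abs_nonneg t)
  have hb0 : 0 < β * |t| := mul_pos hβ (abs_pos.2 ht)
  have hπ := Real.pi_pos
  set q : ℝ := 1 / (2 * Real.pi * (β * |t|)) with hq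
  have hq0 : 0 ≤ q := by positivity
  set fs : ℝ := 4 * q - 4 * Real.pi * (β * |t|) * q ^ 2 with hfs
  have hfval : fs = 1 / (Real.pi * (β * |t|)) := by
    rw [hfs, hq]
    field_simp
    ring
  have hfpos : 0 < fs := by rw [hfval]; positivity
  have hεf : 0 < ε * fs := by positivity
  set K : ℝ := Real.exp (2 * (β * |t|) *
    (2 * Real.pi * q ^ 2 + 76 * q ^ 2 + 544 * q ^ 4 * Real.exp (2 * q ^ 2))) with hK
  have hK0 : 0 < K := Real.exp_pos _
  have hA0 : 0 ≤ pairFieldWeight g := pairFieldWeight_nonneg g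
  have hAK : 0 < (pairFieldWeight g + 1) * K := by positivity
  obtain ⟨R, hR⟩ := exists_limsup_le_rpow
    (fun L z => ‖(hubbardTorusWith 2 (L + 1) t U μ).thermalCorr β
        (localPair g (L + 1) (torusSiteOfInt (L + 1) 0))ᴴ
        (localPair g (L + 1) (torusSiteOfInt (L + 1) z))‖)
    ((pairFieldWeight g + 1) * K) fs (ε * fs) hAK hfpos hεf (fun L z => norm_nonneg _)
    (fun L z => by
      have h := norm_pairFieldCorr_le_rpow_euclid (L + 1) g t U μ β q hβ.le hq0 hfpos.le
        (torusSiteOfInt (L + 1) 0) (torusSiteOfInt (L + 1) z)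
      have hD : 0 ≤ K * ((5 : ℝ) ^ fs *
          ((torusDist (torusSiteOfInt (L + 1) 0) (torusSiteOfInt (L + 1) z) : ℝ) + 1) ^ (-fs)) :=
        by positivity
      calc _ ≤ pairFieldWeight g * (K * ((5 : ℝ) ^ fs *
            ((torusDist (torusSiteOfInt (L + 1) 0) (torusSiteOfInt (L + 1) z) : ℝ) + 1) ^ (-fs))) := h
        _ ≤ (pairFieldWeight g + 1) * (K * ((5 : ℝ) ^ fs *
            ((torusDist (torusSiteOfInt (L + 1) 0) (torusSiteOfInt (L + 1) z) : ℝ) + 1) ^ (-fs))) :=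
          by nlinarith
        _ = _ := by ring)
  refine ⟨R, fun z hz => ?_⟩
  have hexp : -((1 - ε) / (Real.pi * β * |t|)) = -fs + ε * fs := by
    rw [hfval]
    field_simp
    ring
  rw [hexp]
  exact hR z hz

/-! ### The summit's `d_{x²-y²}` pair field, verbatim -/

/-- **The `d_{x²-y²}` pair field of the summit, torus form**: for `T > (π/4)|t|` there are
`f > 1/4` and `C` with `|⟨(P_x)† P_y⟩_{β,L}| ≤ C (dist(x,y)+1)^{-f}` for all `L, x, y`, where
`P_x = localPair dWaveFormFactor L x`; every `U`, `μ`. -/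
theorem dWavePairField_decay_torus (t U μ β : ℝ) (hβ : 0 < β) (hb : β * |t| < 4 / Real.pi) :
    ∃ f C : ℝ, 1 / 4 < f ∧ ∀ (L : ℕ) [NeZero L] (x y : TorusSite 2 L),
      ‖(hubbardTorusWith 2 L t U μ).thermalCorr β (localPair dWaveFormFactor L x)ᴴ
          (localPair dWaveFormFactor L y)‖ ≤ C * ((torusDist x y : ℝ) + 1) ^ (-f) :=
  pairFieldEtaLineEuclid_holds dWaveFormFactor t U μ β hβ hb

/-- **The `d_{x²-y²}` pair field of the summit, thermodynamic-limit form**: for `t ≠ 0`, `β > 0`,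
`ε > 0` and `|z| ≥ R(ε)`, `limsup_{L→∞} |⟨(P_0)† P_z⟩_{β,L+1}| ≤ |z|^{-(1-ε)T/(π|t|)}`,
`P = localPair dWaveFormFactor`; every `U`, `μ`. -/
theorem dWavePairField_limsup_le_rpow (t U μ β : ℝ) (ht : t ≠ 0) (hβ : 0 < β) (ε : ℝ)
    (hε : 0 < ε) :
    ∃ R : ℝ, ∀ z : Fin 2 → ℤ, R ≤ intNorm z →
      Filter.limsup (fun L : ℕ => ‖(hubbardTorusWith 2 (L + 1) t U μ).thermalCorr β
          (localPair dWaveFormFactor (L + 1) (torusSiteOfInt (L + 1) 0))ᴴ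
          (localPair dWaveFormFactor (L + 1) (torusSiteOfInt (L + 1) z))‖)
        Filter.atTop ≤ intNorm z ^ (-((1 - ε) / (Real.pi * β * |t|))) :=
  pairFieldEtaLineSharp_holds dWaveFormFactor t U μ β ht hβ ε hε

end Summit.HubbardSuperconductivity.HubbardLadder.Bounds

end
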